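import Summits.HodgeConjecture.HodgeConjecture.Theorems.R90S4OneDimCharTransferOfWeylPair   -- ★ p862981 (K2E3-p12): `IsStableWeylMeasure`, `IsTwistedWeylMeasure`, `IsNormSection`; brings ★ `R90S4TwistedTransferDefs` (`stableEpsOrbitalIntegral`, `IsStablyEpsConjAt`, `isStablyEpsConjAt_of_isEpsNormPair`, `IsEpsRegularAt`), ★ `R90S4TwistedNormMapLocal` (`IsEpsNormPair`), ★ `Ch4Sec10`
import Summits.HodgeConjecture.HodgeConjecture.Theorems.R90S4EpsCentralizerNormTorus        -- ★ p862700 (K2E3-p36, B3-1): `isRegularElt_coe_of_isEpsNormPair` (norms of ε-regular elements are regular)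
import HarnessLib

/-!
# R90-TF · S4 «Ch. 13.1–2», brick (W6-B4) follow-on — THE TWISTED WEYL DATUM DOES NOT DEPEND ON THE NORM SECTION
# (Rogawski 1990, §12.5 p. 186: the torus variable of the ε-twisted Weyl integration formula runs over `Z̃T̃^N\T̃ = Z\T`, i.e. over NORMS; §3.11 Prop. 3.11.1 (b)–(c))

Cell `hodgecm-mathlib`, crux H413 (`stmt-HodgeConjecture-24833`, lane `--supports … --as helper`), route of record `HCCMUnconditional` (no route verbs;
count-neutral).  Programme R90-TF, section S4 (dealer K2E2-plan → successor; CHAIR K2-lead (g2)); seat K2E3-p12 (g10), follow-on of ★ p862981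
`R90S4OneDimCharTransferOfWeylPair` (brick (W6-B4) «ASSEMBLY 1D-CT»; take-by-default `R90/STATUS.md` 2026-09-04T23:23:38Z), for whoever PAYS the proposed torus-side
sub-socket (W-NP) `∃ ρ sec, IsStableWeylMeasure … ρ ∧ IsTwistedWeylMeasure … ρ sec ∧ IsNormSection … ρ sec` of `Lines/R90_S4_LocalBaseChangeC`.  THEOREMS ONLY — no `def`,
no instance, no notation, no `sorry`; ★-only imports.

## THE MATHEMATICS
Print's ε-twisted Weyl integration formula (p. 186) integrates `D_G(N(δ))² Φ^{st}_ε(δ, φ) α(δ)` over `δ ∈ Z̃T̃^N\T̃`, identified with `Z\T` BY THE NORM: the integrand is a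
function of the stable ε-class of `δ`, and stable ε-classes ARE the fibres of the norm on stable classes (Prop. 3.11.1 (c): «the norm map defines a bijection between
`𝒪_{ε-st}(G̃)` and `𝒪_{st}(G)`»).  In the tree's packaging (★ `IsTwistedWeylMeasure … νGt mGt ρ sec`: `∫ φ·β dνGt = ∫ Φ^{st}_ε(sec γ, φ) β(sec γ) dρ(γ)` for continuous
ε-stable class functions `β`) this reads: (§1) `Φ^{st}_ε(·, φ)` is constant on stable ε-classes (★ `IsStablyEpsConjAt` = conjugacy of norms; it is DEFINED as the sum of
the twisted class orbital integrals over the ε-classes inside the stable ε-class, ★ `stableEpsOrbitalIntegral_eq_finsum`), hence (§2) the right-hand side is unchanged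
when `sec` is replaced by any `sec′` with `sec γ`, `sec′ γ` stably ε-conjugate for `ρ`-a.e. `γ` — in particular by ANY OTHER NORM SECTION (two elements with the common
norm `γ` are stably ε-conjugate, ★ `isStablyEpsConjAt_of_isEpsNormPair`); and (§3) a norm section over `ρ` EXISTS as soon as `ρ`-almost every `γ` is the norm of some
ε-regular `δ` (choice) — for the `ρ` of the stable Weyl formula, which lives on the regular semisimple set, that is Prop. 3.11.1 (b) «Let `γ ∈ G` be semisimple. There exists
`δ ∈ G̃` such that `N(δ) = γ`» (brick B3-3, R90-C131-p03; not restated here).  So the payer of (W-NP) may construct print's formula with ONE convenient section (e.g. `δ ∈ T̃`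
for `γ ∈ T`, p. 186 «`T̃` the centralizer of `T` in `G̃`») and the datum holds for every section; and (§3) `IsNormSection` forces `ρ`-a.e. regularity of `γ`
(★ `isRegularElt_coe_of_isEpsNormPair`).

## CONTENTS (generic in the form `Φ : GL₃(L)`)
* §1 `stableEpsOrbitalIntegral_congr_of_isStablyEpsConjAt` — `δ ∼_{ε-st} δ′ ⇒ Φ^{st}_ε(δ, φ) = Φ^{st}_ε(δ′, φ)` (the ε-twin of ★ `stableOrbitalIntegralRel_congr`);
  `stableEpsOrbitalIntegral_eq_of_isEpsNormPair` — two elements with a common norm have the same `Φ^{st}_ε(·, φ)`.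
* §2 `IsTwistedWeylMeasure.congr_ae` — T-WIF for `(ρ, sec)` and `sec γ ∼_{ε-st} sec′ γ` `ρ`-a.e. ⇒ T-WIF for `(ρ, sec′)`; `IsTwistedWeylMeasure.congr_normSection` — T-WIF is the
  same for any two norm sections over `ρ`; `isTwistedWeylMeasure_iff_of_isNormSection` (the `↔`).
* §3 `IsNormSection.ae_isRegularElt` — under a norm section `ρ`-a.e. `γ` is regular semisimple; `IsNormSection.ae_exists` ∕ `exists_isNormSection_of_ae_exists` ∕
  `exists_isNormSection_iff` — a norm section over `ρ` exists iff `ρ`-a.e. `γ` is the norm of an ε-regular element.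

HONEST LABEL: HC_CM is proved only modulo the 7 printed citations (2 remaining named inputs: hLiu418 = stmt-HodgeConjecture-24832, h413 = stmt-HodgeConjecture-24833)
until rung 0 closes.  API only: discharges no named input; it shows the proposed (W-NP) socket is insensitive to the choice of norm section and that its third
conjunct is Prop. 3.11.1 (b) on the support of `ρ`.  REL ≠ ★ ≠ BUILT.

## References
* [Rogawski1990] J. D. Rogawski, *Automorphic Representations of Unitary Groups in Three Variables*, Ann. of Math. Stud. 123 (1990), §12.5 p. 186; §3.11 Prop. 3.11.1
  (b)–(c) pp. 34–35; §4.10 (4.10.1) p. 57.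
-/

set_option autoImplicit false
set_option linter.dupNamespace false

noncomputable section

open MeasureTheory
open NumberField IsDedekindDomain
open scoped Matrix MatrixGroups
open Literature.NumberTheory.Automorphic Literature.NumberTheory.Automorphic.UnitaryGroup
open Literature.NumberTheory.Rogawski1990 Literature.NumberTheory.Rogawski1990.Ch4Sec10

namespace Summit.HodgeConjecture.HodgeConjecture.R90.S4

variable (L : Type) [Field L] [NumberField L] [IsCMField L] (Φ : GL (Fin 3) L) (v : HeightOneSpectrum (𝓞 ↥(maximalRealSubfield L)))

/-! ## §1 `Φ^{st}_ε(·, φ)` is an ε-stable class function [§4.10 (4.10.1) p. 57; §3.11 Prop. 3.11.1 (c)] -/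

section StableIntegral

variable [∀ δ : GtLoc L v, MeasurableSpace (GtLoc L v ⧸ epsCentralizer (epsLoc L Φ v) δ)]

variable {L Φ v} in
/-- **`Φ^{st}_ε(δ, φ) = Φ^{st}_ε(δ′, φ)` for stably ε-conjugate `δ, δ′`**: the stable ε-twisted orbital integral (★ `stableEpsOrbitalIntegral` = the `finsum` of the twisted
class orbital integrals over the ε-classes `c` with `out c` stably ε-conjugate to `δ`, (4.10.1) at `κ = 1`) depends on `δ` only through its stable ε-class, since
★ `IsStablyEpsConjAt` (conjugacy of norms) is an equivalence relation — the index sets for `δ` and `δ′` coincide.  The ε-twin of ★ `stableOrbitalIntegralRel_congr`.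
[cite: Rogawski1990, §4.10 (4.10.1) p. 57; §3.11 Prop. 3.11.1 (c) p. 34] -/
theorem stableEpsOrbitalIntegral_congr_of_isStablyEpsConjAt {δ δ' : GtLoc L v} (h : IsStablyEpsConjAt L Φ v δ δ')
    (mGt : EpsOrbitalMeasureFamily (epsLoc L Φ v) ⊥) (φ : GtLoc L v → ℂ) :
    stableEpsOrbitalIntegral L Φ v mGt φ δ = stableEpsOrbitalIntegral L Φ v mGt φ δ' := by
  rw [stableEpsOrbitalIntegral_eq_finsum, stableEpsOrbitalIntegral_eq_finsum]
  have hs : {c : EpsConjClassesMod (epsLoc L Φ v) ⊥ | IsStablyEpsConjAt L Φ v δ (Quotient.out c)} =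
      {c : EpsConjClassesMod (epsLoc L Φ v) ⊥ | IsStablyEpsConjAt L Φ v δ' (Quotient.out c)} :=
    Set.ext fun _ => ⟨fun hc => h.symm.trans hc, fun hc => h.trans hc⟩
  rw [hs]

variable {L Φ v} in
/-- **Two elements of `G̃_v` with a common norm `γ ∈ 𝒩(δ) ∩ 𝒩(δ′)` have the same stable ε-twisted orbital integrals** (★ `isStablyEpsConjAt_of_isEpsNormPair` + §1).
[cite: Rogawski1990, §3.11 Prop. 3.11.1 (c) p. 34; §4.10 (4.10.1) p. 57] -/
theorem stableEpsOrbitalIntegral_eq_of_isEpsNormPair {δ δ' : GtLoc L v} {γ : (cmDatum L 3 (Φ : Matrix (Fin 3) (Fin 3) L)).Local v}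
    (hδ : IsEpsNormPair L Φ v δ γ) (hδ' : IsEpsNormPair L Φ v δ' γ) (mGt : EpsOrbitalMeasureFamily (epsLoc L Φ v) ⊥) (φ : GtLoc L v → ℂ) :
    stableEpsOrbitalIntegral L Φ v mGt φ δ = stableEpsOrbitalIntegral L Φ v mGt φ δ' :=
  stableEpsOrbitalIntegral_congr_of_isStablyEpsConjAt (isStablyEpsConjAt_of_isEpsNormPair hδ hδ') mGt φ

end StableIntegral

/-! ## §2 The twisted Weyl datum is insensitive to the norm section [§12.5 p. 186] -/

section Section

variable [MeasurableSpace (GtLoc L v)] [MeasurableSpace ((cmDatum L 3 (Φ : Matrix (Fin 3) (Fin 3) L)).Local v)]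
  [∀ δ : GtLoc L v, MeasurableSpace (GtLoc L v ⧸ epsCentralizer (epsLoc L Φ v) δ)]

variable {L Φ v} in
/-- **T-WIF for `(ρ, sec)` ⇒ T-WIF for `(ρ, sec′)` whenever `sec γ ∼_{ε-st} sec′ γ` for `ρ`-a.e. `γ`**: the torus-side integrand `Φ^{st}_ε(sec γ, φ) β(sec γ)` of
★ `IsTwistedWeylMeasure` is a function of the stable ε-class of `sec γ` (§1 for `Φ^{st}_ε`; `β` is ε-stable by hypothesis), so the right-hand sides agree `ρ`-a.e.
(`integral_congr_ae`). [cite: Rogawski1990, §12.5 p. 186; §3.11 Prop. 3.11.1 (c) p. 34] -/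
theorem IsTwistedWeylMeasure.congr_ae {νGt : Measure (GtLoc L v)} {mGt : EpsOrbitalMeasureFamily (epsLoc L Φ v) ⊥}
    {ρ : Measure ((cmDatum L 3 (Φ : Matrix (Fin 3) (Fin 3) L)).Local v)} {sec sec' : (cmDatum L 3 (Φ : Matrix (Fin 3) (Fin 3) L)).Local v → GtLoc L v}
    (h : IsTwistedWeylMeasure L Φ v νGt mGt ρ sec) (hst : ∀ᵐ γ ∂ρ, IsStablyEpsConjAt L Φ v (sec γ) (sec' γ)) :
    IsTwistedWeylMeasure L Φ v νGt mGt ρ sec' := by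
  intro φ β hφ hβ hβst
  rw [h φ β hφ hβ hβst]
  refine integral_congr_ae ?_
  filter_upwards [hst] with γ hγ
  rw [stableEpsOrbitalIntegral_congr_of_isStablyEpsConjAt hγ mGt φ, hβst _ _ hγ]

variable {L Φ v} in
/-- **The twisted Weyl datum is THE SAME for any two norm sections over `ρ`**: if `(ρ, sec)` is a twisted Weyl datum for `(νGt, mGt)` and `sec`, `sec′` are both norm
sections over `ρ` (★ `IsNormSection`: `ρ`-a.e. `γ ∈ 𝒩(sec γ)` and `γ ∈ 𝒩(sec′ γ)`), then `(ρ, sec′)` is a twisted Weyl datum too — `sec γ`, `sec′ γ` share the norm `γ`, hence are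
stably ε-conjugate (★ `isStablyEpsConjAt_of_isEpsNormPair`).  Print's formula is written over `Z̃T̃^N\T̃ = Z\T`, i.e. over norms, not over chosen preimages.
[cite: Rogawski1990, §12.5 p. 186; §3.11 Prop. 3.11.1 (c) p. 34] -/
theorem IsTwistedWeylMeasure.congr_normSection {νGt : Measure (GtLoc L v)} {mGt : EpsOrbitalMeasureFamily (epsLoc L Φ v) ⊥}
    {ρ : Measure ((cmDatum L 3 (Φ : Matrix (Fin 3) (Fin 3) L)).Local v)} {sec sec' : (cmDatum L 3 (Φ : Matrix (Fin 3) (Fin 3) L)).Local v → GtLoc L v}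
    (h : IsTwistedWeylMeasure L Φ v νGt mGt ρ sec) (hsec : IsNormSection L Φ v ρ sec) (hsec' : IsNormSection L Φ v ρ sec') :
    IsTwistedWeylMeasure L Φ v νGt mGt ρ sec' := by
  refine h.congr_ae ?_
  filter_upwards [hsec, hsec'] with γ hγ hγ'
  exact isStablyEpsConjAt_of_isEpsNormPair hγ.2 hγ'.2

variable {L Φ v} in
/-- For two norm sections over `ρ`, the twisted Weyl datum holds for one iff it holds for the other. [cite: Rogawski1990, §12.5 p. 186] -/
theorem isTwistedWeylMeasure_iff_of_isNormSection {νGt : Measure (GtLoc L v)} {mGt : EpsOrbitalMeasureFamily (epsLoc L Φ v) ⊥}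
    {ρ : Measure ((cmDatum L 3 (Φ : Matrix (Fin 3) (Fin 3) L)).Local v)} {sec sec' : (cmDatum L 3 (Φ : Matrix (Fin 3) (Fin 3) L)).Local v → GtLoc L v}
    (hsec : IsNormSection L Φ v ρ sec) (hsec' : IsNormSection L Φ v ρ sec') :
    IsTwistedWeylMeasure L Φ v νGt mGt ρ sec ↔ IsTwistedWeylMeasure L Φ v νGt mGt ρ sec' :=
  ⟨fun h => h.congr_normSection hsec hsec', fun h => h.congr_normSection hsec' hsec⟩

end Section

/-! ## §3 Norm sections: a.e. regularity, and existence from pointwise norms [§3.11 Prop. 3.11.1 (b) p. 34; §12.5 p. 186] -/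

section NormSection

variable [MeasurableSpace ((cmDatum L 3 (Φ : Matrix (Fin 3) (Fin 3) L)).Local v)]

variable {L Φ v} in
/-- **Under a norm section, `ρ`-almost every `γ` is regular semisimple** (`γ ∈ 𝒩(sec γ)` with `sec γ` ε-regular ⇒ `γ` regular, ★ `isRegularElt_coe_of_isEpsNormPair`): the
torus-side measure of a twisted Weyl datum with a norm section lives on the regular set, as print's `dγ` on `Z\T` does (the `𝒩`-image of the ε-regular set, p. 186).
[cite: Rogawski1990, §12.5 p. 186; §3.11 p. 34] -/
theorem IsNormSection.ae_isRegularElt {ρ : Measure ((cmDatum L 3 (Φ : Matrix (Fin 3) (Fin 3) L)).Local v)}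
    {sec : (cmDatum L 3 (Φ : Matrix (Fin 3) (Fin 3) L)).Local v → GtLoc L v} (h : IsNormSection L Φ v ρ sec) :
    ∀ᵐ γ ∂ρ, IsRegularElt (γ.val : GtLoc L v) := by
  filter_upwards [h] with γ hγ
  exact isRegularElt_coe_of_isEpsNormPair hγ.1 hγ.2

variable {L Φ v} in
/-- Under a norm section, `ρ`-almost every `γ` is the norm of SOME ε-regular element (namely `sec γ`). [cite: Rogawski1990, §3.11 Prop. 3.11.1 (b) p. 34] -/
theorem IsNormSection.ae_exists {ρ : Measure ((cmDatum L 3 (Φ : Matrix (Fin 3) (Fin 3) L)).Local v)}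
    {sec : (cmDatum L 3 (Φ : Matrix (Fin 3) (Fin 3) L)).Local v → GtLoc L v} (h : IsNormSection L Φ v ρ sec) :
    ∀ᵐ γ ∂ρ, ∃ δ : GtLoc L v, IsEpsRegularAt L Φ v δ ∧ IsEpsNormPair L Φ v δ γ := by
  filter_upwards [h] with γ hγ
  exact ⟨sec γ, hγ⟩

/-- **A norm section over `ρ` exists as soon as `ρ`-almost every `γ` is the norm of an ε-regular element** (choose one such `δ` at each `γ`; `1` elsewhere).  With Prop. 3.11.1 (b)
(«Let `γ ∈ G` be semisimple. There exists `δ ∈ G̃` such that `N(δ) = γ`», brick B3-3) this makes the third conjunct of the proposed (W-NP) socket the statement that `ρ` lives on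
the regular semisimple set. [cite: Rogawski1990, §3.11 Prop. 3.11.1 (b) p. 34; §12.5 p. 186] -/
theorem exists_isNormSection_of_ae_exists (ρ : Measure ((cmDatum L 3 (Φ : Matrix (Fin 3) (Fin 3) L)).Local v))
    (h : ∀ᵐ γ ∂ρ, ∃ δ : GtLoc L v, IsEpsRegularAt L Φ v δ ∧ IsEpsNormPair L Φ v δ γ) :
    ∃ sec : (cmDatum L 3 (Φ : Matrix (Fin 3) (Fin 3) L)).Local v → GtLoc L v, IsNormSection L Φ v ρ sec := by
  classical
  refine ⟨fun γ => if hγ : ∃ δ : GtLoc L v, IsEpsRegularAt L Φ v δ ∧ IsEpsNormPair L Φ v δ γ then hγ.choose else 1, ?_⟩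
  filter_upwards [h] with γ hγ
  rw [dif_pos hγ]
  exact hγ.choose_spec

/-- **A norm section over `ρ` exists iff `ρ`-almost every `γ` is the norm of an ε-regular element.** [cite: Rogawski1990, §3.11 Prop. 3.11.1 (b) p. 34] -/
theorem exists_isNormSection_iff (ρ : Measure ((cmDatum L 3 (Φ : Matrix (Fin 3) (Fin 3) L)).Local v)) :
    (∃ sec : (cmDatum L 3 (Φ : Matrix (Fin 3) (Fin 3) L)).Local v → GtLoc L v, IsNormSection L Φ v ρ sec) ↔
      ∀ᵐ γ ∂ρ, ∃ δ : GtLoc L v, IsEpsRegularAt L Φ v δ ∧ IsEpsNormPair L Φ v δ γ :=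
  ⟨fun ⟨_, h⟩ => h.ae_exists, exists_isNormSection_of_ae_exists L Φ v ρ⟩

end NormSection

end Summit.HodgeConjecture.HodgeConjecture.R90.S4

end
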